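import Literature.RepresentationTheory.HeisenbergGroup.HeisenbergGroup
import Mathlib.MeasureTheory.Function.LpSpace.ContinuousCompMeasurePreserving
import Mathlib.MeasureTheory.Function.LpSpace.Complete
import Mathlib.MeasureTheory.Function.L2Space
import Mathlib.MeasureTheory.Group.Measure
import Mathlib.MeasureTheory.Integral.Lebesgue.DominatedConvergence
import Mathlib.Analysis.SpecialFunctions.Pow.Continuity
import Mathlib.RepresentationTheory.Basic
import Mathlib.Analysis.Complex.Circle
import Literature.RepresentationTheory.HeisenbergGroup.LatticeModelContinuous
import HarnessLib

/-!
# The Schrödinger representation of `Heisenberg (polar β)` on `L²(X, ν)` for an invariant measure `ν`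

Topic `RepresentationTheory/HeisenbergGroup`; namespace `Literature.RepresentationTheory.HeisenbergGroup.SchrodingerHaar`.
KERNEL ONLY: definitions with bodies (`chi`, `modulate`, `translate`, `op`, `rep`, `unitary`) and proved theorems.

[Weil1964, Chap. I n° 4 p. 149, n° 11–13] lets the Heisenberg group act on `L²(G)` by the unitary operators
`U(w)Φ(u) = Φ(u + x) ψ(⟨u, y⟩)`; [GelbartRogawski1991, §3.1 p. 454 L19–21] quantifies over "an irreducible unitary
representation `ρ_ψ` of `H_𝐀(W)` with central character `ψ`" on a Hilbert space.  The tree's `schrodingerL2`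
(`SchrodingerL2Unitary.lean`) EXTENDS the smooth model on locally constant compactly supported functions under a density
hypothesis that fails for `X = 𝐀_Fⁿ` or `ℝⁿ`; this file constructs the operators DIRECTLY on `Lp ℂ 2 ν` for any
topological additive group `X` (Borel σ-algebra), right-invariant measure `ν`, `R`-bilinear pairing `β : X × Y → R`
continuous in the first variable and continuous character `ψ` — it applies verbatim to `X = 𝐀_Fⁿ` with a Haar measure:
* §1 the multiplier `chi y = ψ(β(·, y))` and the MODULATIONS `modulate y` (`modulate_coeFn`, isometric, additive in `y`),
  strongly continuous in `y` when `β(u, ·)` is continuous (`continuous_modulate_apply`, dominated convergence);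
* §2 the TRANSLATIONS `translate x = Lp.compMeasurePreserving (· + x)` and Weyl's commutation relation
  `translate x ∘ modulate y = ψ(β x y) • modulate y ∘ translate x` (`translate_modulate`);
* §3 **`rep β ψ hψ hβ ν : Representation ℂ (Heisenberg (polar β)) (Lp ℂ 2 ν)`**,
  `(ρ((x,y),t) f)(u) = ψ(t + β(u, y)) f(u + x)` a.e. (`rep_coeFn`, the normal form of the smooth `schrodingerSB_apply`),
  unitarity (`norm_rep_apply`, `unitary`, `inner_rep_apply`), central character `rep_ofCenter`, junction `rep_toLp`;
* §4 STRONG CONTINUITY: `continuous_translate_apply` (Mathlib's `Lp.compMeasurePreserving_continuous`, every Haar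
  measure), **`continuous_rep_mk_zero`** (`w ↦ ρ(w, 0) f` continuous on `X × Y`), `continuous_rep_mk`.
Irreducibility is not treated here.  Nothing of the cited sources is used as a hypothesis.

## References
* [Weil1964] A. Weil, *Sur certains groupes d'opérateurs unitaires*, Acta Math. 111 (1964), Chap. I n° 4 p. 149, n° 11–13.
* [Folland1989] G. B. Folland, *Harmonic Analysis in Phase Space*, Princeton UP 1989, §1.3 (1.25).
* [MoeglinVignerasWaldspurger1987] C. Mœglin, M.-F. Vignéras, J.-L. Waldspurger, LNM 1291 (1987), Chap. 2 I.3–I.4.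
* [GelbartRogawski1991] S. Gelbart, J. Rogawski, Invent. Math. 105 (1991), §3.1 p. 454 L19–21.
-/

set_option autoImplicit false

noncomputable section

open MeasureTheory Filter
open scoped ENNReal Topology

namespace Literature.RepresentationTheory.HeisenbergGroup

namespace SchrodingerHaar

variable {R : Type*} [CommRing R] {X Y : Type*} [AddCommGroup X] [Module R X] [AddCommGroup Y] [Module R Y]
  (β : X →ₗ[R] Y →ₗ[R] R) (ψ : AddChar R Circle)

/-! ## §1 The multiplier `ψ(β(u, y))` and the modulation operators -/

/-- the multiplier `χ_y(u) = ψ(β(u, y))` of the modulation operator. [cite: Weil1964, Chap. I n° 4 p. 149] -/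
def chi (y : Y) (u : X) : ℂ := ψ (β u y)

/-- unfolding. [cite: Weil1964, Chap. I n° 4 p. 149] -/
theorem chi_apply (y : Y) (u : X) : chi β ψ y u = ψ (β u y) := rfl

/-- `|χ_y(u)| = 1`. [cite: Weil1964, Chap. I n° 4 p. 149] -/
theorem norm_chi (y : Y) (u : X) : ‖chi β ψ y u‖ = 1 := Circle.norm_coe _

/-- `χ_0 = 1`. [cite: Weil1964, Chap. I n° 4 p. 149] -/
theorem chi_zero (u : X) : chi β ψ 0 u = 1 := by
  rw [chi_apply, map_zero, AddChar.map_zero_eq_one, Circle.coe_one]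

/-- `χ_{y + y'} = χ_y χ_{y'}`. [cite: Weil1964, Chap. I n° 4 p. 149] -/
theorem chi_add (y y' : Y) (u : X) : chi β ψ (y + y') u = chi β ψ y u * chi β ψ y' u := by
  rw [chi_apply, chi_apply, chi_apply, map_add, AddChar.map_add_eq_mul, Circle.coe_mul]

/-- `χ_y(u + x) = χ_y(u) ψ(β(x, y))`. [cite: Weil1964, Chap. I n° 4 p. 149] -/
theorem chi_add_left (y : Y) (u x : X) : chi β ψ y (u + x) = chi β ψ y u * ψ (β x y) := by
  rw [chi_apply, chi_apply, map_add, LinearMap.add_apply, AddChar.map_add_eq_mul, Circle.coe_mul]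

variable [TopologicalSpace R] [TopologicalSpace X] (hψ : Continuous (ψ : R → Circle))
  (hβ : ∀ y : Y, Continuous fun u : X => β u y)

include hψ hβ in
/-- `χ_y` is continuous when `ψ` and `β(·, y)` are. [cite: Weil1964, Chap. I n° 11] -/
theorem continuous_chi (y : Y) : Continuous (chi β ψ y) :=
  continuous_subtype_val.comp (hψ.comp (hβ y))

variable [MeasurableSpace X] [BorelSpace X] (ν : Measure X)

include hψ hβ in
/-- `χ_y f ∈ ℒ²` for `f ∈ L²`. [cite: Weil1964, Chap. I n° 11] -/
theorem memLp_chi_mul (y : Y) (f : Lp ℂ 2 ν) : MemLp (fun u => chi β ψ y u * f u) 2 ν :=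
  (Lp.memLp f).of_le (((continuous_chi β ψ hψ hβ y).aestronglyMeasurable).mul (Lp.aestronglyMeasurable f))
    (Eventually.of_forall fun u => by rw [norm_mul, norm_chi, one_mul])

/-- **the modulation operator `f ↦ χ_y f = ψ(β(·, y)) f` on `L²(X, ν)`**. [cite: Weil1964, Chap. I n° 4 p. 149] -/
def modulate (y : Y) : Lp ℂ 2 ν →ₗ[ℂ] Lp ℂ 2 ν where
  toFun f := (memLp_chi_mul β ψ hψ hβ ν y f).toLp _
  map_add' f g := by
    rw [← MemLp.toLp_add (memLp_chi_mul β ψ hψ hβ ν y f) (memLp_chi_mul β ψ hψ hβ ν y g)]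
    refine MemLp.toLp_congr _ _ ?_
    filter_upwards [Lp.coeFn_add f g] with u hu
    rw [hu, Pi.add_apply, Pi.add_apply, mul_add]
  map_smul' c f := by
    rw [RingHom.id_apply, ← MemLp.toLp_const_smul c (memLp_chi_mul β ψ hψ hβ ν y f)]
    refine MemLp.toLp_congr _ _ ?_
    filter_upwards [Lp.coeFn_smul c f] with u hu
    rw [hu, Pi.smul_apply, Pi.smul_apply, smul_eq_mul, smul_eq_mul, mul_left_comm]

/-- `(modulate y f)(u) = χ_y(u) f(u)` a.e. [cite: Weil1964, Chap. I n° 4 p. 149] -/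
theorem modulate_coeFn (y : Y) (f : Lp ℂ 2 ν) :
    ⇑(modulate β ψ hψ hβ ν y f) =ᵐ[ν] fun u => chi β ψ y u * f u :=
  MemLp.coeFn_toLp (memLp_chi_mul β ψ hψ hβ ν y f)

/-- **`modulate y` is isometric** (`|χ_y| = 1`). [cite: Weil1964, Chap. I n° 11] -/
theorem norm_modulate (y : Y) (f : Lp ℂ 2 ν) : ‖modulate β ψ hψ hβ ν y f‖ = ‖f‖ := by
  have h : ∀ᵐ u ∂ν, ‖modulate β ψ hψ hβ ν y f u‖ = ‖f u‖ :=
    (modulate_coeFn β ψ hψ hβ ν y f).mono fun u hu => by rw [hu, norm_mul, norm_chi, one_mul]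
  rw [Lp.norm_def, Lp.norm_def, eLpNorm_congr_norm_ae h]

/-- `modulate 0 = id`. [cite: Weil1964, Chap. I n° 4 p. 149] -/
theorem modulate_zero (f : Lp ℂ 2 ν) : modulate β ψ hψ hβ ν 0 f = f :=
  Lp.ext <| by filter_upwards [modulate_coeFn β ψ hψ hβ ν 0 f] with u hu; rw [hu, chi_zero, one_mul]

/-- `modulate (y + y') = modulate y ∘ modulate y'`. [cite: Weil1964, Chap. I n° 4 p. 149] -/
theorem modulate_add (y y' : Y) (f : Lp ℂ 2 ν) :
    modulate β ψ hψ hβ ν (y + y') f = modulate β ψ hψ hβ ν y (modulate β ψ hψ hβ ν y' f) := by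
  apply Lp.ext
  filter_upwards [modulate_coeFn β ψ hψ hβ ν (y + y') f, modulate_coeFn β ψ hψ hβ ν y (modulate β ψ hψ hβ ν y' f),
    modulate_coeFn β ψ hψ hβ ν y' f] with u h1 h2 h3
  rw [h1, h2, h3, chi_add, mul_assoc]

/-- **strong continuity of the modulations**: if moreover `β(u, ·)` is continuous for every `u` (`Y` first
countable), then `y ↦ modulate y f` is continuous for every `f ∈ L²(X, ν)` (dominated convergence).
[cite: Folland1989, §1.3 (1.25)] -/
theorem continuous_modulate_apply [TopologicalSpace Y] [FirstCountableTopology Y]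
    (hβ' : ∀ u : X, Continuous fun y : Y => β u y) (f : Lp ℂ 2 ν) :
    Continuous fun y : Y => modulate β ψ hψ hβ ν y f := by
  refine continuous_iff_continuousAt.2 fun y₀ => ?_
  rw [ContinuousAt, Lp.tendsto_Lp_iff_tendsto_eLpNorm']
  set F : Y → X → ℝ≥0∞ := fun y u => ‖(chi β ψ y u - chi β ψ y₀ u) * f u‖ₑ ^ (2 : ℝ) with hF
  have hmeas : ∀ y, AEStronglyMeasurable (fun u => (chi β ψ y u - chi β ψ y₀ u) * f u) ν := fun y =>
    (((continuous_chi β ψ hψ hβ y).sub (continuous_chi β ψ hψ hβ y₀)).aestronglyMeasurable).mul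
      (Lp.aestronglyMeasurable f)
  have hnorm : ∀ y, eLpNorm (⇑(modulate β ψ hψ hβ ν y f) - ⇑(modulate β ψ hψ hβ ν y₀ f)) 2 ν =
      (∫⁻ u, F y u ∂ν) ^ (1 / 2 : ℝ) := by
    intro y
    have hae : ⇑(modulate β ψ hψ hβ ν y f) - ⇑(modulate β ψ hψ hβ ν y₀ f) =ᵐ[ν]
        fun u => (chi β ψ y u - chi β ψ y₀ u) * f u := by
      filter_upwards [modulate_coeFn β ψ hψ hβ ν y f, modulate_coeFn β ψ hψ hβ ν y₀ f] with u h1 h2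
      rw [Pi.sub_apply, h1, h2, sub_mul]
    rw [eLpNorm_congr_ae hae, eLpNorm_eq_lintegral_rpow_enorm_toReal two_ne_zero ENNReal.ofNat_ne_top,
      ENNReal.toReal_ofNat]
  simp_rw [hnorm]
  have hf2 : ∫⁻ u, ‖f u‖ₑ ^ (2 : ℝ) ∂ν < ∞ := by
    have h := (Lp.memLp f).eLpNorm_lt_top
    rw [eLpNorm_eq_lintegral_rpow_enorm_toReal two_ne_zero ENNReal.ofNat_ne_top, ENNReal.toReal_ofNat] at h
    exact (ENNReal.rpow_lt_top_iff_of_pos (by norm_num : (0 : ℝ) < 1 / 2)).1 h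
  have hlim : Tendsto (fun y => ∫⁻ u, F y u ∂ν) (𝓝 y₀) (𝓝 0) := by
    have h := tendsto_lintegral_filter_of_dominated_convergence' (μ := ν) (l := 𝓝 y₀) (F := F)
      (f := fun _ => 0) (fun u => (2 * ‖f u‖ₑ) ^ (2 : ℝ))
      (Eventually.of_forall fun y => ((hmeas y).aemeasurable.enorm.pow_const _))
      (Eventually.of_forall fun y => Eventually.of_forall fun u => ?_) ?_ (Eventually.of_forall fun u => ?_)
    · simpa only [lintegral_zero] using h
    · -- `|χ_y − χ_{y₀}|² |f|² ≤ (2|f|)²`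
      refine ENNReal.rpow_le_rpow ?_ (by norm_num)
      rw [enorm_mul]
      refine mul_le_mul' ((enorm_sub_le).trans ?_) le_rfl
      rw [← ofReal_norm, ← ofReal_norm, norm_chi, norm_chi, ENNReal.ofReal_one]
      exact le_of_eq one_add_one_eq_two
    · have h4 : ∫⁻ u, (2 * ‖f u‖ₑ) ^ (2 : ℝ) ∂ν =
          (2 : ℝ≥0∞) ^ (2 : ℝ) * ∫⁻ u, ‖f u‖ₑ ^ (2 : ℝ) ∂ν := by
        rw [← lintegral_const_mul' _ _ (ENNReal.rpow_ne_top_of_nonneg (by norm_num) ENNReal.ofNat_ne_top)]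
        refine lintegral_congr fun u => ?_
        rw [ENNReal.mul_rpow_of_nonneg _ _ (by norm_num)]
      rw [h4]
      exact ENNReal.mul_ne_top (ENNReal.rpow_ne_top_of_nonneg (by norm_num) ENNReal.ofNat_ne_top) hf2.ne
    · have hc : Continuous fun y => F y u :=
        ENNReal.continuous_rpow_const.comp
          ((((continuous_subtype_val.comp (hψ.comp (hβ' u))).sub continuous_const).mul
            continuous_const).enorm)
      have h0 : F y₀ u = 0 := by
        rw [hF]; simp only [sub_self, zero_mul, enorm_zero, ENNReal.zero_rpow_of_pos two_pos]
      simpa only [h0] using hc.tendsto y₀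
  have h := (ENNReal.continuous_rpow_const (y := (1 / 2 : ℝ))).tendsto (0 : ℝ≥0∞)
  rw [ENNReal.zero_rpow_of_pos (by norm_num : (0 : ℝ) < 1 / 2)] at h
  exact h.comp hlim

/-! ## §2 Translations and Weyl's commutation relation -/

variable [IsTopologicalAddGroup X] [ν.IsAddRightInvariant]

/-- **the translation isometry `f ↦ f(· + x)` of `L²(X, ν)`** (`ν` right invariant). [cite: Weil1964, Chap. I n° 4] -/
def translate (x : X) : Lp ℂ 2 ν →ₗᵢ[ℂ] Lp ℂ 2 ν :=
  Lp.compMeasurePreservingₗᵢ ℂ (fun u : X => u + x) (measurePreserving_add_right ν x)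

/-- unfolding. [cite: Weil1964, Chap. I n° 4 p. 149] -/
theorem translate_apply (x : X) (f : Lp ℂ 2 ν) :
    translate ν x f = Lp.compMeasurePreserving (fun u : X => u + x) (measurePreserving_add_right ν x) f := rfl

/-- `(translate x f)(u) = f(u + x)` a.e. [cite: Weil1964, Chap. I n° 4 p. 149] -/
theorem translate_coeFn (x : X) (f : Lp ℂ 2 ν) : ⇑(translate ν x f) =ᵐ[ν] fun u => f (u + x) :=
  Lp.coeFn_compMeasurePreserving f _

/-- `translate 0 = id`. [cite: Weil1964, Chap. I n° 4 p. 149] -/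
theorem translate_zero (f : Lp ℂ 2 ν) : translate ν (0 : X) f = f :=
  Lp.ext <| by filter_upwards [translate_coeFn ν (0 : X) f] with u hu; rw [hu, add_zero]

/-- `translate (x + x') = translate x' ∘ translate x`. [cite: Weil1964, Chap. I n° 4 p. 149] -/
theorem translate_add (x x' : X) (f : Lp ℂ 2 ν) :
    translate ν (x + x') f = translate ν x' (translate ν x f) := by
  apply Lp.ext
  have e := (measurePreserving_add_right ν x').quasiMeasurePreserving.ae_eq_comp (translate_coeFn ν x f)
  filter_upwards [translate_coeFn ν (x + x') f, translate_coeFn ν x' (translate ν x f), e] with u h1 h2 h3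
  simp only [Function.comp_apply] at h3
  rw [h1, h2, h3, add_comm x x', ← add_assoc]

/-- **Weyl's commutation relation** `translate x ∘ modulate y = ψ(β(x, y)) • modulate y ∘ translate x`.
[cite: Folland1989, §1.3 (1.25)] -/
theorem translate_modulate (x : X) (y : Y) (f : Lp ℂ 2 ν) :
    translate ν x (modulate β ψ hψ hβ ν y f) =
      ((ψ (β x y) : Circle) : ℂ) • modulate β ψ hψ hβ ν y (translate ν x f) := by
  apply Lp.ext
  have h2 := (measurePreserving_add_right ν x).quasiMeasurePreserving.ae_eq_comp
    (modulate_coeFn β ψ hψ hβ ν y f)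
  filter_upwards [translate_coeFn ν x (modulate β ψ hψ hβ ν y f), h2,
    Lp.coeFn_smul ((ψ (β x y) : Circle) : ℂ) (modulate β ψ hψ hβ ν y (translate ν x f)),
    modulate_coeFn β ψ hψ hβ ν y (translate ν x f), translate_coeFn ν x f] with u h1 h2 h3 h4 h5
  simp only [Function.comp_apply] at h2
  rw [h1, h2, h3, Pi.smul_apply, h4, h5, smul_eq_mul, chi_add_left]
  ring

/-! ## §3 The representation -/

/-- the operator `ρ((x, y), t) = ψ(t) • modulate y ∘ translate x` as a linear map. [cite: Weil1964, Chap. I n° 4 p. 149] -/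
def op (h : Heisenberg (polar β)) : Lp ℂ 2 ν →ₗ[ℂ] Lp ℂ 2 ν :=
  ((ψ h.t : Circle) : ℂ) • ((modulate β ψ hψ hβ ν h.v.2).comp (translate ν h.v.1).toLinearMap)

/-- unfolding. [cite: Weil1964, Chap. I n° 4 p. 149] -/
theorem op_apply (h : Heisenberg (polar β)) (f : Lp ℂ 2 ν) :
    op β ψ hψ hβ ν h f = ((ψ h.t : Circle) : ℂ) • modulate β ψ hψ hβ ν h.v.2 (translate ν h.v.1 f) := rfl

/-- `(ρ(h) f)(u) = ψ(t + β(u, y)) f(u + x)` a.e., `h = ((x, y), t)`. [cite: Weil1964, Chap. I n° 4 p. 149] -/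
theorem op_coeFn (h : Heisenberg (polar β)) (f : Lp ℂ 2 ν) :
    ⇑(op β ψ hψ hβ ν h f) =ᵐ[ν] fun u => ((ψ (h.t + β u h.v.2) : Circle) : ℂ) * f (u + h.v.1) := by
  rw [op_apply]
  filter_upwards [Lp.coeFn_smul ((ψ h.t : Circle) : ℂ) (modulate β ψ hψ hβ ν h.v.2 (translate ν h.v.1 f)),
    modulate_coeFn β ψ hψ hβ ν h.v.2 (translate ν h.v.1 f), translate_coeFn ν h.v.1 f] with u h1 h2 h3
  rw [h1, Pi.smul_apply, h2, h3, smul_eq_mul, AddChar.map_add_eq_mul, Circle.coe_mul, chi_apply, mul_assoc]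

/-- `ρ(1) = id`. [cite: Weil1964, Chap. I n° 4 p. 149] -/
theorem op_one (f : Lp ℂ 2 ν) : op β ψ hψ hβ ν 1 f = f := by
  rw [op_apply, Heisenberg.one_t, Heisenberg.one_v, Prod.fst_zero, Prod.snd_zero, translate_zero,
    modulate_zero, AddChar.map_zero_eq_one, Circle.coe_one, one_smul]

/-- `ρ(h h') = ρ(h) ρ(h')` for the law `(w, t)(w', t') = (w + w', t + t' + β(x, y'))`. [cite: Weil1964, Chap. I n° 4] -/
theorem op_mul (h h' : Heisenberg (polar β)) (f : Lp ℂ 2 ν) :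
    op β ψ hψ hβ ν (h * h') f = op β ψ hψ hβ ν h (op β ψ hψ hβ ν h' f) := by
  apply Lp.ext
  have e := (measurePreserving_add_right ν h.v.1).quasiMeasurePreserving.ae_eq_comp (op_coeFn β ψ hψ hβ ν h' f)
  filter_upwards [op_coeFn β ψ hψ hβ ν (h * h') f, op_coeFn β ψ hψ hβ ν h (op β ψ hψ hβ ν h' f), e]
    with u h1 h2 h3
  simp only [Function.comp_apply] at h3
  rw [h1, h2, h3]
  simp only [Heisenberg.mul_t, Heisenberg.mul_v, polar_apply, Prod.fst_add, Prod.snd_add, map_add,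
    LinearMap.add_apply]
  rw [← mul_assoc, ← Circle.coe_mul, ← AddChar.map_add_eq_mul, ← add_assoc u]
  exact congrArg₂ (· * ·) (congrArg (fun r : R => ((ψ r : Circle) : ℂ)) (by ring)) rfl

/-- **the Schrödinger representation `ρ_ψ` of `Heisenberg (polar β)` on the Hilbert space `L²(X, ν)`**,
`(ρ((x, y), t) f)(u) = ψ(t + β(u, y)) f(u + x)`. [cite: Weil1964, Chap. I n° 4, 11–13] [cite: Folland1989, §1.3 (1.25)] -/
def rep : Representation ℂ (Heisenberg (polar β)) (Lp ℂ 2 ν) where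
  toFun := op β ψ hψ hβ ν
  map_one' := LinearMap.ext (op_one β ψ hψ hβ ν)
  map_mul' h h' := LinearMap.ext (op_mul β ψ hψ hβ ν h h')

/-- unfolding: `ρ(h) f = ψ(t) • modulate y (translate x f)`. [cite: Weil1964, Chap. I n° 4 p. 149] -/
theorem rep_apply (h : Heisenberg (polar β)) (f : Lp ℂ 2 ν) :
    rep β ψ hψ hβ ν h f = ((ψ h.t : Circle) : ℂ) • modulate β ψ hψ hβ ν h.v.2 (translate ν h.v.1 f) := rfl

/-- **`(ρ(h) f)(u) = ψ(t + β(u, y)) f(u + x)` a.e.**, `h = ((x, y), t)`. [cite: MoeglinVignerasWaldspurger1987, Chap. 2 I.4] -/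
theorem rep_coeFn (h : Heisenberg (polar β)) (f : Lp ℂ 2 ν) :
    ⇑(rep β ψ hψ hβ ν h f) =ᵐ[ν] fun u => ((ψ (h.t + β u h.v.2) : Circle) : ℂ) * f (u + h.v.1) :=
  op_coeFn β ψ hψ hβ ν h f

/-- `ρ(w, 0) f = modulate y (translate x f)`. [cite: Weil1964, Chap. I n° 4 p. 149] -/
theorem rep_mk_zero (w : X × Y) (f : Lp ℂ 2 ν) :
    rep β ψ hψ hβ ν ⟨w, 0⟩ f = modulate β ψ hψ hβ ν w.2 (translate ν w.1 f) := by
  rw [rep_apply, AddChar.map_zero_eq_one, Circle.coe_one, one_smul]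

/-- **unitarity**: `‖ρ(h) f‖ = ‖f‖`. [cite: GelbartRogawski1991, §3.1 p. 454 L19–21] -/
theorem norm_rep_apply (h : Heisenberg (polar β)) (f : Lp ℂ 2 ν) : ‖rep β ψ hψ hβ ν h f‖ = ‖f‖ := by
  rw [rep_apply, norm_smul, Circle.norm_coe, one_mul, norm_modulate, (translate ν h.v.1).norm_map]

/-- **central character `ψ`**: `ρ(0, t) f = ψ(t) f`. [cite: GelbartRogawski1991, §3.1 p. 454 L19–21] -/
theorem rep_ofCenter (t : R) (f : Lp ℂ 2 ν) :
    rep β ψ hψ hβ ν (Heisenberg.ofCenter (polar β) (Multiplicative.ofAdd t)) f = ((ψ t : Circle) : ℂ) • f := by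
  rw [rep_apply, Heisenberg.ofCenter_t, Heisenberg.ofCenter_v, toAdd_ofAdd, Prod.fst_zero, Prod.snd_zero,
    translate_zero, modulate_zero]

include hψ hβ in
/-- `u ↦ ψ(t + β(u, y)) g(u + x)` is in `ℒ²` for `g ∈ ℒ²`. [cite: Weil1964, Chap. I n° 11] -/
theorem memLp_formula (h : Heisenberg (polar β)) {g : X → ℂ} (hg : MemLp g 2 ν) :
    MemLp (fun u => ((ψ (h.t + β u h.v.2) : Circle) : ℂ) * g (u + h.v.1)) 2 ν := by
  have h1 : MemLp (fun u => g (u + h.v.1)) 2 ν := hg.comp_measurePreserving (measurePreserving_add_right ν h.v.1)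
  have h2 : MemLp (fun u => chi β ψ h.v.2 u * g (u + h.v.1)) 2 ν :=
    h1.of_le (((continuous_chi β ψ hψ hβ h.v.2).aestronglyMeasurable).mul h1.1)
      (Eventually.of_forall fun u => by rw [norm_mul, norm_chi, one_mul])
  refine (h2.const_mul ((ψ h.t : Circle) : ℂ)).ae_eq (Eventually.of_forall fun u => ?_)
  dsimp only
  rw [chi_apply, ← mul_assoc, ← Circle.coe_mul, ← AddChar.map_add_eq_mul]

/-- **junction with function models**: for `g ∈ ℒ²(X, ν)`, `ρ(h)[g] = [u ↦ ψ(t + β(u, y)) g(u + x)]` — `rep` extends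
every smooth model given by the same formula (`schrodingerSB`, `adelicSchrodinger`). [cite: Weil1964, Chap. I n° 13] -/
theorem rep_toLp (h : Heisenberg (polar β)) {g : X → ℂ} (hg : MemLp g 2 ν) :
    rep β ψ hψ hβ ν h (hg.toLp g) = (memLp_formula β ψ hψ hβ ν h hg).toLp _ := by
  apply Lp.ext
  have e := (measurePreserving_add_right ν h.v.1).quasiMeasurePreserving.ae_eq_comp hg.coeFn_toLp
  filter_upwards [rep_coeFn β ψ hψ hβ ν h (hg.toLp g), (memLp_formula β ψ hψ hβ ν h hg).coeFn_toLp, e]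
    with u h1 h2 h3
  simp only [Function.comp_apply] at h3
  rw [h1, h2, h3]

/-- **the operators `ρ(h)` as unitaries** of `L²(X, ν)`, inverse `ρ(h⁻¹)`. [cite: GelbartRogawski1991, §3.1 p. 454] -/
def unitary (h : Heisenberg (polar β)) : Lp ℂ 2 ν ≃ₗᵢ[ℂ] Lp ℂ 2 ν where
  toLinearEquiv := LinearEquiv.ofLinear (rep β ψ hψ hβ ν h) (rep β ψ hψ hβ ν h⁻¹)
    (by rw [← Module.End.mul_eq_comp, ← map_mul, mul_inv_cancel, map_one, Module.End.one_eq_id])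
    (by rw [← Module.End.mul_eq_comp, ← map_mul, inv_mul_cancel, map_one, Module.End.one_eq_id])
  norm_map' := norm_rep_apply β ψ hψ hβ ν h

/-- `ρ(h)` preserves inner products. [cite: GelbartRogawski1991, §3.1 p. 454 L19–21] -/
theorem inner_rep_apply (h : Heisenberg (polar β)) (f g : Lp ℂ 2 ν) :
    inner ℂ (rep β ψ hψ hβ ν h f) (rep β ψ hψ hβ ν h g) = inner ℂ f g :=
  (unitary β ψ hψ hβ ν h).inner_map_map f g

/-! ## §4 Strong continuity -/

variable [R1Space X] [IsLocallyFiniteMeasure ν] [ν.InnerRegularCompactLTTop]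

/-- **strong continuity of the translations**: `x ↦ translate x f` is continuous for `f ∈ L²(X, ν)` when `ν` is locally
finite and inner regular on finite-measure sets (every Haar measure). [cite: Folland1989, §1.3 (1.25)] -/
theorem continuous_translate_apply (f : Lp ℂ 2 ν) : Continuous fun x : X => translate ν x f := by
  let F : C(X × X, X) := ⟨fun p => p.2 + p.1, continuous_snd.add continuous_fst⟩
  have hm : ∀ x : X, MeasurePreserving (F.curry x) ν ν := fun x => measurePreserving_add_right ν x
  exact continuous_const.compMeasurePreservingLp (f := fun _ : X => f) F.curry.continuous hm ENNReal.ofNat_ne_top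

/-- **strong continuity of `ρ_ψ` on `W = X × Y`**: `w ↦ ρ(w, 0) f` is continuous for every `f ∈ L²(X, ν)`
(`β` separately continuous, `ψ` continuous, `Y` first countable, `ν` Haar-like). [cite: Folland1989, §1.3 (1.25)] -/
theorem continuous_rep_mk_zero [TopologicalSpace Y] [FirstCountableTopology Y]
    (hβ' : ∀ u : X, Continuous fun y : Y => β u y) (f : Lp ℂ 2 ν) :
    Continuous fun w : X × Y => rep β ψ hψ hβ ν ⟨w, 0⟩ f := by
  have h := LatticeModel.continuous_apply_apply_of_isometry (A := modulate β ψ hψ hβ ν) (norm_modulate β ψ hψ hβ ν)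
    (continuous_modulate_apply β ψ hψ hβ ν hβ') continuous_snd ((continuous_translate_apply ν f).comp continuous_fst)
  simpa only [rep_mk_zero, Function.comp_apply] using h

/-- strong continuity on the whole group: `((w, t)) ↦ ρ(w, t) f` is continuous. [cite: Folland1989, §1.3 (1.25)] -/
theorem continuous_rep_mk [TopologicalSpace Y] [FirstCountableTopology Y]
    (hβ' : ∀ u : X, Continuous fun y : Y => β u y) (f : Lp ℂ 2 ν) :
    Continuous fun p : (X × Y) × R => rep β ψ hψ hβ ν ⟨p.1, p.2⟩ f := by
  have h : Continuous fun p : (X × Y) × R => ((ψ p.2 : Circle) : ℂ) • rep β ψ hψ hβ ν ⟨p.1, 0⟩ f :=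
    (continuous_subtype_val.comp (hψ.comp continuous_snd)).smul
      ((continuous_rep_mk_zero β ψ hψ hβ ν hβ' f).comp continuous_fst)
  exact h.congr fun p => by rw [rep_mk_zero, rep_apply]

end SchrodingerHaar

end Literature.RepresentationTheory.HeisenbergGroup

end

/-! ## §5 (appendix) The central coordinate acts by the character -/

namespace Literature.RepresentationTheory.HeisenbergGroup.SchrodingerHaar

open _root_.MeasureTheory

variable {R : Type*} [CommRing R] {X Y : Type*} [AddCommGroup X] [Module R X] [AddCommGroup Y] [Module R Y]
  (β : X →ₗ[R] Y →ₗ[R] R) (ψ : AddChar R Circle) [TopologicalSpace R] [TopologicalSpace X]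
  (hψ : Continuous (ψ : R → Circle)) (hβ : ∀ y : Y, Continuous fun u : X => β u y)
  [MeasurableSpace X] [BorelSpace X] (ν : Measure X) [IsTopologicalAddGroup X] [ν.IsAddRightInvariant]

/-- `ρ((x, y), t) = ψ(t) • ρ((x, y), 0)`: the central coordinate acts by the character `ψ` (used to compare the
Schrödinger operators of two pairings with different central characters). [cite: Weil1964, Chap. I n° 4 p. 149] -/
theorem rep_mk_eq_smul_rep_mk_zero (w : X × Y) (t : R) (f : Lp ℂ 2 ν) :
    rep β ψ hψ hβ ν ⟨w, t⟩ f = ((ψ t : Circle) : ℂ) • rep β ψ hψ hβ ν ⟨w, 0⟩ f := by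
  rw [rep_apply, rep_mk_zero]

end Literature.RepresentationTheory.HeisenbergGroup.SchrodingerHaar
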